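import Literature.Geometry.Riemannian.CanonicalNeighbourhoods
import Literature.Geometry.Riemannian.LipschitzSmoothing
import Literature.Geometry.Lorentzian.DalembertianCompose
import Mathlib.MeasureTheory.Integral.IntervalIntegral.ContDiff
import Mathlib.Analysis.Calculus.MeanValue
import Mathlib.Analysis.SpecialFunctions.Sqrt
import HarnessLib

/-!
# Integrating the gradient estimates `|∇R| < η R^{3/2}`, `|∂R/∂t| < η R²`
(topic `Geometry/Riemannian`)

Elementary consequences of the two **gradient estimates** of the canonical neighbourhood
assumption of Chen–Zhu 2006 (§5, arXiv p. 26, built into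
`Literature.Geometry.Riemannian.HasCanonicalNeighbourhood`; Thm. 4.1, (4.1), p. 19: "each point
`(x₀, t₀)` with `R(x₀, t₀) ≥ r₀⁻²` satisfies `|∇R(x₀,t₀)| < 2η R^{3/2}(x₀,t₀)` and
`|∂R/∂t (x₀,t₀)| < 2η R²(x₀,t₀)`"), which §4 (p. 24: "The estimates (4.1) imply that `Ω` is
open and `R(x,t) → +∞` as `t → T` for each `x ∈ M ∖ Ω`") and §5 (Lemma 5.2, Prop. 5.4) use in
integrated form. Both estimates say that `R^{-1/2}`, resp. `R⁻¹`, is Lipschitz (in space with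
respect to `g(t)`, resp. in time) wherever `R` is above the threshold; this file proves the
integrated inequalities, for an arbitrary smooth function `R` on a Riemannian manifold (space)
and an arbitrary real function (time), with the "last exit from `{R ≤ K}`" argument that handles
the threshold. Served: the surgery step of the proof of
`Literature.Geometry.Riemannian.chenZhu_ricciFlowWithSurgery` (Chen–Zhu 2006, Thm. 1.1), through
`SingularTimeBoundedSet.lean` (the set `Ω` at a singular time).

* `ofReal_abs_sub_le_mul_length` — **integrating a bound on the differential along a path**: if
  `f` is `C¹` on an open `U` with `|df_x(v)| ≤ L |v|_g` there, then along every `C¹` path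
  `γ : [a, b] → U`, `|f(γ b) − f(γ a)| ≤ L · L_g(γ)` (fundamental theorem of calculus for
  `f ∘ γ` and `|(f ∘ γ)'| ≤ L |γ'|_g`); `ofReal_abs_sub_le_mul_riemEDist` — hence `f` is
  `L`-Lipschitz for the Riemannian distance on every geodesic ball contained in `U`.
* `le_of_gradient_estimate_path`, `le_of_gradient_estimate_of_riemEDist_lt`,
  `le_four_mul_of_gradient_estimate` — **the spatial estimate**: if `|∇R| ≤ η R^{3/2}` on
  `{R ≥ K}` (`K > 0`) and `R(x) ≥ K`, then `R(y) ≤ (R(x)^{-1/2} − (η/2) d)⁻²` whenever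
  `d(x, y) < d` and `(η/2) d < R(x)^{-1/2}`; in particular `R ≤ 4 R(x)` on the ball
  `B(x, 1/(η R(x)^{1/2}))` (the form used throughout Perelman 2002/2003 and Chen–Zhu 2006, e.g.
  §4, p. 24 and the proof of Lemma 5.2).
* `abs_inv_sub_inv_le_of_deriv_le_sq`, `lt_and_inv_le_of_deriv_le_sq` (backward),
  `le_inv_sub_of_deriv_le_sq` (forward) — **the time estimate**: if `|φ'| ≤ η φ²` wherever
  `φ ≥ K > 0`, then `φ⁻¹` is `η`-Lipschitz on intervals where `φ ≥ K`; if `φ(b)` is so large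
  that `φ(b)⁻¹ + η (b − a) < K⁻¹` then `φ > K` on `[a, b]` with `φ(s)⁻¹ ≤ φ(b)⁻¹ + η (b − s)`;
  and `φ(a) ≤ L` (`L ≥ K`) gives `φ(s) ≤ (L⁻¹ − η (s − a))⁻¹` while `η (s − a) < L⁻¹`.

Everything here is proved; there are no definitions and no named facts.

## References

* B.-L. Chen, X.-P. Zhu, *Ricci flow with surgery on four-manifolds with positive isotropic
  curvature*, J. Differential Geom. 74 (2006) 177–264 (arXiv:math/0504478): Thm. 4.1 with
  (4.1) (p. 19); §4, p. 24; §5, p. 26 (canonical neighbourhood assumption). [ChenZhu2006]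
* G. Perelman, *The entropy formula for the Ricci flow and its geometric applications*,
  arXiv:math/0211159 (2002), §12.1 (the gradient estimates of `κ`-solutions and their use).
  [Perelman2002]
-/

noncomputable section

open Bundle Set Filter MeasureTheory Manifold
open scoped Manifold ContDiff Topology ENNReal NNReal

namespace Literature.Geometry.Riemannian

open Lorentzian

/-! ### Integrating a bound on the differential along a `C¹` path -/

section PathIntegration

variable {E : Type*} [NormedAddCommGroup E] [NormedSpace ℝ E] [FiniteDimensional ℝ E]
  {H : Type*} [TopologicalSpace H] {I : ModelWithCorners ℝ E H}
  {M : Type*} [TopologicalSpace M] [ChartedSpace H M] [IsManifold I ∞ M]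

/-- From `|a| ≤ C √(g(v,v)) = C |v|_g` to the inequality of extended norms: the `|a| = ‖a‖`
adapter (dedup-00648) of the tree's `Literature.Geometry.Lorentzian.enorm_le_coe_mul_enorm_of_norm_le`
(`VolumeChartFormula.lean`), which carries the actual proof. [folklore] -/
private theorem enorm_le_mul_enorm_aux {V : Type*} [SeminormedAddCommGroup V] {a : ℝ} {v : V}
    {C : ℝ≥0} (h : |a| ≤ C * ‖v‖) : ‖a‖ₑ ≤ (C : ℝ≥0∞) * ‖v‖ₑ :=
  enorm_le_coe_mul_enorm_of_norm_le ((Real.norm_eq_abs a).trans_le h)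

/-- **Integrating a bound on the differential along a path.** Let `g` be a Riemannian metric,
`f` a real function of class `C¹` on an open set `U`, and `γ` a `C¹` path on `[a, b]` with
values in `U` such that `|df_{γ t}(v)| ≤ L · g(v,v)^{1/2}` for all `t ∈ [a, b]` and all tangent
vectors `v` at `γ t`. Then `|f(γ b) − f(γ a)| ≤ L · L_g(γ|[a,b])`: by the fundamental theorem of
calculus `|f(γ b) − f(γ a)| ≤ ∫_a^b |(f ∘ γ)'|`, and `(f ∘ γ)'(t) = df_{γ t}(γ'(t))` is at most
`L |γ'(t)|_g`, whose integral is `L` times the length (O'Neill 1983, Ch. 5, Def. 11). This is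
the step "it would follow from the gradient estimates (4.1) that `R̄` is uniformly bounded in
some small neighborhood" of Chen–Zhu 2006, §4, p. 24, in general form. [folklore] -/
theorem ofReal_abs_sub_le_mul_length
    (g : PseudoRiemannianMetric I ∞ E (TangentSpace I : M → Type _)) (hg : g.IsRiemannian)
    {f : M → ℝ} {U : Set M} (hU : IsOpen U) (hf : ContMDiffOn I 𝓘(ℝ, ℝ) 1 f U) {L : ℝ≥0}
    {γ : ℝ → M} {a b : ℝ} (hab : a ≤ b) (hγ : ContMDiffOn 𝓘(ℝ, ℝ) I 1 γ (Icc a b))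
    (hγU : MapsTo γ (Icc a b) U)
    (hL : ∀ t ∈ Icc a b, ∀ v : TangentSpace I (γ t),
      |mvfderiv I f (γ t) v| ≤ L * Real.sqrt (g.val (γ t) v v)) :
    ENNReal.ofReal |f (γ b) - f (γ a)| ≤ L * g.length hg γ a b := by
  rcases hab.eq_or_lt with rfl | hab'
  · simp
  letI := g.riemannianBundle hg
  set F : ℝ → ℝ := f ∘ γ with hF
  have hFm : ContMDiffOn 𝓘(ℝ, ℝ) 𝓘(ℝ, ℝ) 1 F (Icc a b) := hf.comp hγ hγU
  have hFd : ContDiffOn ℝ 1 F (Icc a b) := contMDiffOn_iff_contDiffOn.1 hFm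
  -- the derivative of `f ∘ γ` within `[a, b]` is `df (γ')`
  have hderiv : ∀ t ∈ Icc a b, derivWithin F (Icc a b) t =
      mvfderiv I f (γ t) (mfderivWithin 𝓘(ℝ, ℝ) I γ (Icc a b) t 1) := by
    intro t ht
    have huniq : UniqueMDiffWithinAt 𝓘(ℝ, ℝ) (Icc a b) t := by
      rw [uniqueMDiffWithinAt_iff_uniqueDiffWithinAt]
      exact uniqueDiffOn_Icc hab' t ht
    have hft : MDifferentiableAt I 𝓘(ℝ, ℝ) f (γ t) :=
      (hf.contMDiffAt (hU.mem_nhds (hγU ht))).mdifferentiableAt one_ne_zero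
    have hγt : MDifferentiableWithinAt 𝓘(ℝ, ℝ) I γ (Icc a b) t :=
      (hγ.mdifferentiableOn one_ne_zero) t ht
    have hcomp : mfderivWithin 𝓘(ℝ, ℝ) 𝓘(ℝ, ℝ) F (Icc a b) t =
        (mfderiv I 𝓘(ℝ, ℝ) f (γ t)).comp (mfderivWithin 𝓘(ℝ, ℝ) I γ (Icc a b) t) :=
      mfderiv_comp_mfderivWithin t hft hγt huniq
    have h1 : derivWithin F (Icc a b) t = mfderivWithin 𝓘(ℝ, ℝ) 𝓘(ℝ, ℝ) F (Icc a b) t 1 := by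
      simp only [mfderivWithin_eq_fderivWithin, ← fderivWithin_derivWithin]
      rfl
    rw [h1, hcomp]
    rfl
  calc ENNReal.ofReal |f (γ b) - f (γ a)|
      = ‖F b - F a‖ₑ := by rw [Real.enorm_eq_ofReal_abs]; rfl
    _ ≤ ∫⁻ t in Icc a b, ‖derivWithin F (Icc a b) t‖ₑ :=
        enorm_sub_le_lintegral_derivWithin_Icc_of_contDiffOn_Icc hFd hab
    _ ≤ ∫⁻ t in Icc a b, (L : ℝ≥0∞) * ‖mfderivWithin 𝓘(ℝ, ℝ) I γ (Icc a b) t 1‖ₑ := by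
        refine setLIntegral_mono' measurableSet_Icc fun t ht ↦ ?_
        rw [hderiv t ht]
        refine enorm_le_mul_enorm_aux ?_
        rw [g.norm_eq_sqrt hg]
        exact hL t ht _
    _ = L * g.length hg γ a b := by
        rw [lintegral_const_mul' _ _ ENNReal.coe_ne_top]
        simp only [PseudoRiemannianMetric.length, pathELength_eq_lintegral_mfderivWithin_Icc]

/-- Along a `C¹` path the points `γ t`, `t ∈ [a, b]`, are within the length of `γ|[a,b]` of
`γ a`. [folklore] -/
theorem riemEDist_le_length
    (g : PseudoRiemannianMetric I ∞ E (TangentSpace I : M → Type _)) (hg : g.IsRiemannian)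
    {γ : ℝ → M} {a b : ℝ} (hγ : ContMDiffOn 𝓘(ℝ, ℝ) I 1 γ (Icc a b)) {t : ℝ} (ht : t ∈ Icc a b) :
    g.riemEDist (γ a) (γ t) ≤ g.length hg γ a b := by
  letI := g.riemannianBundle hg
  rw [PseudoRiemannianMetric.riemEDist_eq hg]
  calc g.edist hg (γ a) (γ t) ≤ g.length hg γ a t :=
        g.edist_le_length hg ht.1 (hγ.mono (Icc_subset_Icc_right ht.2))
    _ ≤ g.length hg γ a b := by
        simp only [PseudoRiemannianMetric.length]
        exact pathELength_mono le_rfl ht.2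

/-- Lengths of sub-paths are smaller. [folklore] -/
theorem length_mono
    (g : PseudoRiemannianMetric I ∞ E (TangentSpace I : M → Type _)) (hg : g.IsRiemannian)
    (γ : ℝ → M) {a a' b b' : ℝ} (ha : a' ≤ a) (hb : b ≤ b') :
    g.length hg γ a b ≤ g.length hg γ a' b' := by
  letI := g.riemannianBundle hg
  simp only [PseudoRiemannianMetric.length]
  exact pathELength_mono ha hb

/-- **A function with `|df| ≤ L |·|_g` near a geodesic ball is `L`-Lipschitz there for the
Riemannian distance**: if `f` is `C¹` on an open `U ⊇ B_g(x, ρ)` with `|df_z(v)| ≤ L |v|_g` on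
`U`, then `|f(x) − f(y)| ≤ L · d_g(x, y)` for every `y ∈ B_g(x, ρ)` — a path from `x` to `y` of
length `< r ≤ ρ` stays in the ball, `ofReal_abs_sub_le_mul_length` applies, and `r ↓ d(x,y)`.
[folklore] -/
theorem ofReal_abs_sub_le_mul_riemEDist
    (g : PseudoRiemannianMetric I ∞ E (TangentSpace I : M → Type _)) (hg : g.IsRiemannian)
    {f : M → ℝ} {U : Set M} (hU : IsOpen U) (hf : ContMDiffOn I 𝓘(ℝ, ℝ) 1 f U) {L : ℝ≥0}
    (hL : ∀ z ∈ U, ∀ v : TangentSpace I z, |mvfderiv I f z v| ≤ L * Real.sqrt (g.val z v v))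
    {x : M} {ρ : ℝ≥0∞} (hρ : g.ball x ρ ⊆ U) {y : M} (hy : y ∈ g.ball x ρ) :
    ENNReal.ofReal |f x - f y| ≤ L * g.riemEDist x y := by
  letI := g.riemannianBundle hg
  have hdist : ∀ z, g.riemEDist x z = riemannianEDist I x z := fun z ↦
    PseudoRiemannianMetric.riemEDist_eq hg x z
  rw [PseudoRiemannianMetric.mem_ball] at hy
  -- main estimate for every `r` between `d(x, y)` and `ρ`
  have key : ∀ r, g.riemEDist x y < r → r ≤ ρ → ENNReal.ofReal |f x - f y| ≤ L * r := by
    intro r hr hrρ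
    rw [hdist] at hr
    obtain ⟨γ, hγx, hγy, hγs, hγl⟩ := exists_lt_of_riemannianEDist_lt hr
    have hγl' : g.length hg γ 0 1 < r := hγl
    have hγU : MapsTo γ (Icc 0 1) U := by
      intro t ht
      apply hρ
      rw [PseudoRiemannianMetric.mem_ball, ← hγx]
      exact ((riemEDist_le_length g hg hγs ht).trans_lt hγl').trans_le hrρ
    have h := ofReal_abs_sub_le_mul_length g hg hU hf zero_le_one hγs hγU
      (fun t ht v ↦ hL (γ t) (hγU ht) v)
    rw [hγx, hγy, abs_sub_comm] at h
    exact h.trans (by gcongr)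
  obtain ⟨r₀, hr₀, hr₀ρ⟩ := exists_between hy
  rcases eq_or_ne L 0 with rfl | hL0
  · have h := key r₀ hr₀ hr₀ρ.le
    simp only [ENNReal.coe_zero, zero_mul, nonpos_iff_eq_zero] at h
    rw [h]
    exact bot_le
  have hL0' : (L : ℝ≥0∞) ≠ 0 := by exact_mod_cast hL0
  have hdiv : ENNReal.ofReal |f x - f y| / L ≤ g.riemEDist x y := by
    refine le_of_forall_gt_imp_ge_of_dense fun r hr ↦ ?_
    have h := key (min r r₀) (lt_min hr hr₀) ((min_le_right _ _).trans hr₀ρ.le)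
    calc ENNReal.ofReal |f x - f y| / L ≤ min r r₀ := ENNReal.div_le_of_le_mul' h
      _ ≤ r := min_le_left _ _
  calc ENNReal.ofReal |f x - f y| = L * (ENNReal.ofReal |f x - f y| / L) := by
        rw [ENNReal.mul_div_cancel hL0' ENNReal.coe_ne_top]
    _ ≤ L * g.riemEDist x y := by gcongr

end PathIntegration

/-! ### Two one-variable lemmas: limits from the right, last exit from a sublevel set -/

section Real

/-- If `φ` is continuous on `[a, b]`, `s₀ ∈ [a, b)` and `K ≤ φ` on `(s₀, b]`, then `K ≤ φ s₀`.
[folklore] -/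
theorem le_of_forall_Ioc_le {φ : ℝ → ℝ} {a b s₀ K : ℝ} (hφ : ContinuousOn φ (Icc a b))
    (hs₀ : s₀ ∈ Icc a b) (hs₀b : s₀ < b) (h : ∀ s ∈ Ioc s₀ b, K ≤ φ s) : K ≤ φ s₀ := by
  have hsub : Ioc s₀ b ⊆ Icc a b := fun s hs ↦ ⟨hs₀.1.trans hs.1.le, hs.2⟩
  have hcont : ContinuousWithinAt φ (Ioc s₀ b) s₀ := (hφ s₀ hs₀).mono hsub
  have hmem : s₀ ∈ closure (Ioc s₀ b) := by
    rw [closure_Ioc hs₀b.ne]; exact ⟨le_rfl, hs₀b.le⟩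
  haveI : (𝓝[Ioc s₀ b] s₀).NeBot := mem_closure_iff_nhdsWithin_neBot.1 hmem
  exact ge_of_tendsto hcont (eventually_mem_nhdsWithin.mono h)

/-- **Last exit from a closed sublevel set.** For `φ` continuous on `[a, b]`, if `φ s ≤ K` for
some `s ∈ [a, b]` then there is a last such parameter `s₀`: `s₀ ∈ [a, b]`, `φ s₀ ≤ K`, and
`K < φ s` for every `s ∈ (s₀, b]` (`s₀` is the supremum of the closed set
`{s ∈ [a, b] | φ s ≤ K}`). [folklore] -/
theorem exists_last_exit {φ : ℝ → ℝ} {a b K : ℝ} (hφ : ContinuousOn φ (Icc a b))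
    (hne : ∃ s ∈ Icc a b, φ s ≤ K) :
    ∃ s₀ ∈ Icc a b, φ s₀ ≤ K ∧ ∀ s ∈ Ioc s₀ b, K < φ s := by
  set S : Set ℝ := Icc a b ∩ φ ⁻¹' Iic K with hS
  have hSc : IsClosed S := hφ.preimage_isClosed_of_isClosed isClosed_Icc isClosed_Iic
  have hSne : S.Nonempty := by
    obtain ⟨s, hs, hsK⟩ := hne
    exact ⟨s, hs, hsK⟩
  have hSb : BddAbove S := ⟨b, fun s hs ↦ hs.1.2⟩
  have hmem : sSup S ∈ S := hSc.csSup_mem hSne hSb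
  refine ⟨sSup S, hmem.1, hmem.2, fun s hs ↦ ?_⟩
  by_contra hle
  push Not at hle
  have : s ≤ sSup S := le_csSup hSb ⟨⟨hmem.1.1.trans hs.1.le, hs.2⟩, hle⟩
  exact absurd hs.1 (not_lt.2 this)

end Real

/-! ### The spatial estimate: integrating `|∇R| ≤ η R^{3/2}` -/

section Space

variable {E : Type*} [NormedAddCommGroup E] [NormedSpace ℝ E] [FiniteDimensional ℝ E]
  {H : Type*} [TopologicalSpace H] {I : ModelWithCorners ℝ E H}
  {M : Type*} [TopologicalSpace M] [ChartedSpace H M] [IsManifold I ∞ M]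

/-- The derivative of `r ↦ r^{-1/2}` at `r > 0` is `-(2 r √r)⁻¹`. [folklore] -/
theorem hasDerivAt_inv_sqrt {r : ℝ} (hr : 0 < r) :
    HasDerivAt (fun s ↦ (Real.sqrt s)⁻¹) (-(2 * r * Real.sqrt r)⁻¹) r := by
  have hsq : Real.sqrt r ≠ 0 := (Real.sqrt_pos.2 hr).ne'
  have h : HasDerivAt (fun s ↦ (Real.sqrt s)⁻¹) (-(1 / (2 * Real.sqrt r)) / Real.sqrt r ^ 2) r :=
    (Real.hasDerivAt_sqrt hr.ne').inv hsq
  refine h.congr_deriv ?_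
  rw [Real.sq_sqrt hr.le, neg_div, div_div, one_div, mul_right_comm]

/-- `r ↦ r^{-1/2}` is smooth at `r > 0`. [folklore] -/
theorem contDiffAt_inv_sqrt {r : ℝ} (hr : 0 < r) {n : WithTop ℕ∞} :
    ContDiffAt ℝ n (fun s ↦ (Real.sqrt s)⁻¹) r :=
  (Real.contDiffAt_sqrt hr.ne').inv (Real.sqrt_pos.2 hr).ne'

/-- **The differential of `R^{-1/2}` under the gradient estimate**: for a Riemannian `g` and a
function `R` differentiable at a point `z` with `R z > 0` and `|∇R|_g(z) ≤ η R(z)^{3/2}`, one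
has `|d(R^{-1/2})_z(v)| ≤ (η/2) |v|_g` (chain rule and Cauchy–Schwarz `|dR(v)| ≤ |∇R| |v|`).
[cite: ChenZhu2006, §4, p. 24 (use of (4.1))] -/
theorem abs_mvfderiv_inv_sqrt_le
    (g : PseudoRiemannianMetric I ∞ E (TangentSpace I : M → Type _)) (hg : g.IsRiemannian)
    {R : M → ℝ} {z : M} (hR : MDifferentiableAt I 𝓘(ℝ, ℝ) R z) (hRz : 0 < R z) {η : ℝ}
    (hgrad : Real.sqrt (g.gradSq R z) ≤ η * (R z * Real.sqrt (R z)))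
    (v : TangentSpace I z) :
    |mvfderiv I (fun w ↦ (Real.sqrt (R w))⁻¹) z v| ≤ η / 2 * Real.sqrt (g.val z v v) := by
  have hζ := hasDerivAt_inv_sqrt hRz
  have hcomp : mvfderiv I ((fun s ↦ (Real.sqrt s)⁻¹) ∘ R) z v =
      deriv (fun s ↦ (Real.sqrt s)⁻¹) (R z) * mvfderiv I R z v :=
    PseudoRiemannianMetric.mvfderiv_real_comp hζ.differentiableAt hR v
  have hsq : 0 < Real.sqrt (R z) := Real.sqrt_pos.2 hRz
  have hprod : 0 < 2 * R z * Real.sqrt (R z) := by positivity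
  rw [show (fun w ↦ (Real.sqrt (R w))⁻¹) = (fun s ↦ (Real.sqrt s)⁻¹) ∘ R from rfl, hcomp,
    hζ.deriv, abs_mul, abs_neg, abs_inv, abs_of_pos hprod]
  have hCS := abs_mvfderiv_le_sqrt_gradSq_mul_sqrt g hg R z v
  have hvv : 0 ≤ Real.sqrt (g.val z v v) := Real.sqrt_nonneg _
  calc (2 * R z * Real.sqrt (R z))⁻¹ * |mvfderiv I R z v|
      ≤ (2 * R z * Real.sqrt (R z))⁻¹ *
          (η * (R z * Real.sqrt (R z)) * Real.sqrt (g.val z v v)) := by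
        gcongr
        exact hCS.trans (mul_le_mul_of_nonneg_right hgrad hvv)
    _ = (2 * R z * Real.sqrt (R z))⁻¹ *
          ((2 * R z * Real.sqrt (R z)) * (η / 2 * Real.sqrt (g.val z v v))) := by
        congr 1; ring
    _ = η / 2 * Real.sqrt (g.val z v v) := inv_mul_cancel_left₀ hprod.ne' _

/-- **The spatial gradient estimate integrated along a path** (Chen–Zhu 2006, §4, p. 24; the
computation behind "`R ≤ 4R(x₀, t₀)` on `B_{t₀}(x₀, c R(x₀,t₀)^{-1/2})`" throughout Perelman
2002, §12 and Chen–Zhu 2006, §§4–5). Let `g` be Riemannian and `R` of class `C¹` with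
`|∇R|_g ≤ η R^{3/2}` at every point where `R ≥ K` (`K > 0`, `η ≥ 0`). If `γ` is a `C¹` path on
`[a, b]` from a point with `R(γ a) ≥ K`, of length at most `ℓ` with `(η/2) ℓ < R(γ a)^{-1/2}`,
then `R(γ b) ≤ (R(γ a)^{-1/2} − (η/2) ℓ)⁻²`. *Proof.* If `R(γ b) ≤ K` the bound is trivial
(`K ≤ R(γ a) ≤ RHS`). Otherwise let `s₀` be the last parameter with `R(γ s₀) ≤ K` (or
`s₀ = a`); on `[s₀, b]` the path runs in `{R ≥ K}`, where `R^{-1/2}` has differential bounded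
by `η/2` (`abs_mvfderiv_inv_sqrt_le`), so
`R(γ b)^{-1/2} ≥ R(γ s₀)^{-1/2} − (η/2) ℓ ≥ R(γ a)^{-1/2} − (η/2) ℓ`
(`ofReal_abs_sub_le_mul_length`). [cite: ChenZhu2006, §4, p. 24] [cite: ChenZhu2006, Thm. 4.1, (4.1) (p. 19)] -/
theorem le_of_gradient_estimate_path
    (g : PseudoRiemannianMetric I ∞ E (TangentSpace I : M → Type _)) (hg : g.IsRiemannian)
    {R : M → ℝ} (hR : ContMDiff I 𝓘(ℝ, ℝ) 1 R) {K η : ℝ} (hK : 0 < K) (hη : 0 ≤ η)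
    (hgrad : ∀ z, K ≤ R z → Real.sqrt (g.gradSq R z) ≤ η * (R z * Real.sqrt (R z)))
    {γ : ℝ → M} {a b : ℝ} (hab : a ≤ b) (hγ : ContMDiffOn 𝓘(ℝ, ℝ) I 1 γ (Icc a b))
    (ha : K ≤ R (γ a)) {ℓ : ℝ} (hℓ : g.length hg γ a b ≤ ENNReal.ofReal ℓ) (hℓ0 : 0 ≤ ℓ)
    (hsmall : η / 2 * ℓ < (Real.sqrt (R (γ a)))⁻¹) :
    R (γ b) ≤ ((Real.sqrt (R (γ a)))⁻¹ - η / 2 * ℓ)⁻¹ ^ 2 := by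
  -- positivity
  have hRa : 0 < R (γ a) := hK.trans_le ha
  have hsa : 0 < Real.sqrt (R (γ a)) := Real.sqrt_pos.2 hRa
  have hc : 0 < (Real.sqrt (R (γ a)))⁻¹ - η / 2 * ℓ := sub_pos.2 hsmall
  have hηℓ : 0 ≤ η / 2 * ℓ := by positivity
  -- the trivial case `R (γ b) ≤ R (γ a)`
  have htriv : R (γ b) ≤ R (γ a) → R (γ b) ≤ ((Real.sqrt (R (γ a)))⁻¹ - η / 2 * ℓ)⁻¹ ^ 2 := by
    intro hle
    refine hle.trans ?_
    have h2 : ((Real.sqrt (R (γ a)))⁻¹)⁻¹ ≤ ((Real.sqrt (R (γ a)))⁻¹ - η / 2 * ℓ)⁻¹ :=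
      inv_anti₀ hc (by linarith)
    have h3 := pow_le_pow_left₀ (inv_nonneg.2 (inv_nonneg.2 hsa.le)) h2 2
    rwa [inv_inv, Real.sq_sqrt hRa.le] at h3
  by_cases hb : R (γ b) ≤ K
  · exact htriv (hb.trans ha)
  push Not at hb
  -- continuity of `R ∘ γ` on `[a, b]`
  have hφ : ContinuousOn (R ∘ γ) (Icc a b) := hR.continuous.comp_continuousOn hγ.continuousOn
  -- the last exit `s₀` from `{R ≤ K}` (or `s₀ = a`): `K ≤ R (γ s₀) ≤ R (γ a)`, `K ≤ R` after `s₀`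
  obtain ⟨s₀, hs₀, hRs₀a, hKs₀, hafter⟩ : ∃ s₀ ∈ Icc a b, R (γ s₀) ≤ R (γ a) ∧ K ≤ R (γ s₀) ∧
      ∀ s ∈ Icc s₀ b, K ≤ R (γ s) := by
    by_cases hne : ∃ s ∈ Icc a b, (R ∘ γ) s ≤ K
    · obtain ⟨s₀, hs₀, hs₀K, hlt⟩ := exists_last_exit hφ hne
      have hs₀K' : R (γ s₀) ≤ K := hs₀K
      have hs₀b : s₀ < b := lt_of_le_of_ne hs₀.2 (by rintro rfl; exact absurd hs₀K' hb.not_ge)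
      have hKs₀ : K ≤ R (γ s₀) := le_of_forall_Ioc_le hφ hs₀ hs₀b fun s hs ↦ (hlt s hs).le
      refine ⟨s₀, hs₀, hs₀K'.trans ha, hKs₀, fun s hs ↦ ?_⟩
      rcases hs.1.eq_or_lt with rfl | hlt'
      · exact hKs₀
      · exact (hlt s ⟨hlt', hs.2⟩).le
    · push Not at hne
      exact ⟨a, left_mem_Icc.2 hab, le_rfl, ha, fun s hs ↦ (hne s hs).le⟩
  -- `u = R^{-1/2}` is `C¹` on the open set `{K/2 < R}` with `|du| ≤ η/2` along `γ|[s₀, b]`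
  set u : M → ℝ := fun w ↦ (Real.sqrt (R w))⁻¹ with hu
  set U : Set M := {z | K / 2 < R z} with hUdef
  have hUo : IsOpen U := isOpen_lt continuous_const hR.continuous
  have huU : ContMDiffOn I 𝓘(ℝ, ℝ) 1 u U := by
    intro z hz
    have hRz : 0 < R z := (half_pos hK).trans hz
    have h1 : ContMDiffAt 𝓘(ℝ, ℝ) 𝓘(ℝ, ℝ) 1 (fun s ↦ (Real.sqrt s)⁻¹) (R z) :=
      (contDiffAt_inv_sqrt hRz).contMDiffAt
    exact (h1.comp z (hR z)).contMDiffWithinAt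
  have hγ' : ContMDiffOn 𝓘(ℝ, ℝ) I 1 γ (Icc s₀ b) := hγ.mono (Icc_subset_Icc_left hs₀.1)
  have hγU : MapsTo γ (Icc s₀ b) U := fun s hs ↦
    show K / 2 < R (γ s) from (half_lt_self hK).trans_le (hafter s hs)
  set L : ℝ≥0 := (η / 2).toNNReal with hLdef
  have hLcoe : (L : ℝ) = η / 2 := Real.coe_toNNReal _ (by positivity)
  have hL : ∀ t ∈ Icc s₀ b, ∀ v : TangentSpace I (γ t),
      |mvfderiv I u (γ t) v| ≤ L * Real.sqrt (g.val (γ t) v v) := by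
    intro t ht v
    rw [hLcoe]
    have hKt := hafter t ht
    exact abs_mvfderiv_inv_sqrt_le g hg ((hR (γ t)).mdifferentiableAt one_ne_zero)
      (hK.trans_le hKt) (hgrad _ hKt) v
  have hint := ofReal_abs_sub_le_mul_length g hg hUo huU hs₀.2 hγ' hγU hL
  -- in real terms: `|u (γ b) - u (γ s₀)| ≤ (η/2) ℓ`
  have hlen : g.length hg γ s₀ b ≤ ENNReal.ofReal ℓ :=
    (length_mono g hg γ hs₀.1 le_rfl).trans hℓ
  have hreal : |u (γ b) - u (γ s₀)| ≤ η / 2 * ℓ := by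
    have h1 : ENNReal.ofReal |u (γ b) - u (γ s₀)| ≤ ENNReal.ofReal (η / 2 * ℓ) := by
      calc ENNReal.ofReal |u (γ b) - u (γ s₀)| ≤ L * g.length hg γ s₀ b := hint
        _ ≤ L * ENNReal.ofReal ℓ := by gcongr
        _ = ENNReal.ofReal (η / 2 * ℓ) := by
            rw [ENNReal.ofReal_mul (by positivity : (0 : ℝ) ≤ η / 2)]
            rfl
    exact (ENNReal.ofReal_le_ofReal_iff (by positivity)).1 h1
  -- `u (γ s₀) ≥ u (γ a)` since `K ≤ R (γ s₀) ≤ R (γ a)`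
  have hus₀ : (Real.sqrt (R (γ a)))⁻¹ ≤ u (γ s₀) := by
    have hpos : 0 < Real.sqrt (R (γ s₀)) := Real.sqrt_pos.2 (hK.trans_le hKs₀)
    exact inv_anti₀ hpos (Real.sqrt_le_sqrt hRs₀a)
  -- hence `u (γ b) ≥ c > 0` and `R (γ b) = u(γ b)⁻² ≤ c⁻²`
  have hub : (Real.sqrt (R (γ a)))⁻¹ - η / 2 * ℓ ≤ u (γ b) := by
    have := (abs_sub_le_iff.1 hreal).2
    linarith
  have hRb : 0 < R (γ b) := hK.trans hb
  have h1 : R (γ b) = (u (γ b))⁻¹ ^ 2 := by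
    simp only [hu, inv_inv, Real.sq_sqrt hRb.le]
  rw [h1]
  exact pow_le_pow_left₀ (inv_nonneg.2 (hc.le.trans hub)) (inv_anti₀ hc hub) 2

/-- **The spatial gradient estimate, distance form**: under the hypotheses of
`le_of_gradient_estimate_path` on `g`, `R`, `K`, `η`, if `R(x) ≥ K`, `d_g(x, y) < d` and
`(η/2) d < R(x)^{-1/2}`, then `R(y) ≤ (R(x)^{-1/2} − (η/2) d)⁻²` (take a path of length `< d`).
[cite: ChenZhu2006, §4, p. 24] -/
theorem le_of_gradient_estimate_of_riemEDist_lt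
    (g : PseudoRiemannianMetric I ∞ E (TangentSpace I : M → Type _)) (hg : g.IsRiemannian)
    {R : M → ℝ} (hR : ContMDiff I 𝓘(ℝ, ℝ) 1 R) {K η : ℝ} (hK : 0 < K) (hη : 0 ≤ η)
    (hgrad : ∀ z, K ≤ R z → Real.sqrt (g.gradSq R z) ≤ η * (R z * Real.sqrt (R z)))
    {x y : M} (hx : K ≤ R x) {d : ℝ} (hd : 0 ≤ d) (hxy : g.riemEDist x y < ENNReal.ofReal d)
    (hsmall : η / 2 * d < (Real.sqrt (R x))⁻¹) :
    R y ≤ ((Real.sqrt (R x))⁻¹ - η / 2 * d)⁻¹ ^ 2 := by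
  letI := g.riemannianBundle hg
  rw [PseudoRiemannianMetric.riemEDist_eq hg] at hxy
  have hxy' : riemannianEDist I x y < ENNReal.ofReal d := hxy
  obtain ⟨γ, hγx, hγy, hγs, hγl⟩ := exists_lt_of_riemannianEDist_lt hxy'
  have hγl' : g.length hg γ 0 1 ≤ ENNReal.ofReal d := hγl.le
  subst hγx hγy
  exact le_of_gradient_estimate_path g hg hR hK hη hgrad zero_le_one hγs hx hγl' hd hsmall

/-- **`R ≤ 4 R(x)` on the ball `B_g(x, 1/(η R(x)^{1/2}))`** (the standard consequence of the
gradient estimate `|∇R| ≤ η R^{3/2}` on `{R ≥ K}` at a point with `R(x) ≥ K`; `η > 0`):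
`R(x)^{-1/2} − (η/2) · (η R(x)^{1/2})⁻¹ = R(x)^{-1/2}/2`. [cite: ChenZhu2006, §4, p. 24] -/
theorem le_four_mul_of_gradient_estimate
    (g : PseudoRiemannianMetric I ∞ E (TangentSpace I : M → Type _)) (hg : g.IsRiemannian)
    {R : M → ℝ} (hR : ContMDiff I 𝓘(ℝ, ℝ) 1 R) {K η : ℝ} (hK : 0 < K) (hη : 0 < η)
    (hgrad : ∀ z, K ≤ R z → Real.sqrt (g.gradSq R z) ≤ η * (R z * Real.sqrt (R z)))
    {x y : M} (hx : K ≤ R x)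
    (hy : y ∈ g.ball x (ENNReal.ofReal (η * Real.sqrt (R x))⁻¹)) : R y ≤ 4 * R x := by
  have hRx : 0 < R x := hK.trans_le hx
  have hsx : 0 < Real.sqrt (R x) := Real.sqrt_pos.2 hRx
  have hη0 : η ≠ 0 := hη.ne'
  have hsx0 : Real.sqrt (R x) ≠ 0 := hsx.ne'
  have hd0 : 0 ≤ (η * Real.sqrt (R x))⁻¹ := by positivity
  have hkey : (Real.sqrt (R x))⁻¹ - η / 2 * (η * Real.sqrt (R x))⁻¹ =
      (Real.sqrt (R x))⁻¹ / 2 := by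
    rw [mul_inv, ← mul_assoc, div_mul_eq_mul_div, mul_inv_cancel₀ hη0, one_div]
    ring
  have hsmall : η / 2 * (η * Real.sqrt (R x))⁻¹ < (Real.sqrt (R x))⁻¹ := by
    have : 0 < (Real.sqrt (R x))⁻¹ := inv_pos.2 hsx
    linarith [hkey]
  have h := le_of_gradient_estimate_of_riemEDist_lt g hg hR hK hη.le hgrad hx hd0 hy hsmall
  rw [hkey] at h
  have h2 : ((Real.sqrt (R x))⁻¹ / 2)⁻¹ = 2 * Real.sqrt (R x) := by
    rw [inv_div, div_inv_eq_mul]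
  calc R y ≤ ((Real.sqrt (R x))⁻¹ / 2)⁻¹ ^ 2 := h
    _ = 4 * R x := by
        rw [h2, mul_pow, Real.sq_sqrt hRx.le]
        norm_num

end Space

/-! ### The time estimate: integrating `|φ'| ≤ η φ²` -/

section Time

/-- **`φ⁻¹` is `η`-Lipschitz where `φ ≥ K`**: if `φ` has derivative `φ'` within `[u, v]` at
every point of `[u, v]`, with `K ≤ φ` (`K > 0`) and `|φ'| ≤ η φ²` there, then
`|φ(v)⁻¹ − φ(u)⁻¹| ≤ η (v − u)` (mean value inequality for `φ⁻¹`, `(φ⁻¹)' = −φ'/φ²`). The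
computation behind "`|∂R/∂t| < η R²` … `R(x,t) → +∞`" (Chen–Zhu 2006, §4, p. 24).
[cite: ChenZhu2006, §4, p. 24] -/
theorem abs_inv_sub_inv_le_of_deriv_le_sq {φ φ' : ℝ → ℝ} {u v K η : ℝ} (huv : u ≤ v)
    (hK : 0 < K) (hder : ∀ s ∈ Icc u v, HasDerivWithinAt φ (φ' s) (Icc u v) s)
    (hKφ : ∀ s ∈ Icc u v, K ≤ φ s) (hb : ∀ s ∈ Icc u v, |φ' s| ≤ η * φ s ^ 2) :
    |(φ v)⁻¹ - (φ u)⁻¹| ≤ η * (v - u) := by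
  have hpos : ∀ s ∈ Icc u v, 0 < φ s := fun s hs ↦ hK.trans_le (hKφ s hs)
  have hder' : ∀ s ∈ Icc u v,
      HasDerivWithinAt (fun s ↦ (φ s)⁻¹) (-(φ' s) / φ s ^ 2) (Icc u v) s := fun s hs ↦
    (hder s hs).inv (hpos s hs).ne'
  have hbound : ∀ s ∈ Icc u v, ‖-(φ' s) / φ s ^ 2‖ ≤ η := by
    intro s hs
    have h2 : 0 < φ s ^ 2 := pow_pos (hpos s hs) 2
    rw [Real.norm_eq_abs, abs_div, abs_neg, abs_of_pos h2, div_le_iff₀ h2]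
    exact hb s hs
  have h := (convex_Icc u v).norm_image_sub_le_of_norm_hasDerivWithin_le hder' hbound
    (left_mem_Icc.2 huv) (right_mem_Icc.2 huv)
  rw [Real.norm_eq_abs, Real.norm_eq_abs, abs_of_nonneg (sub_nonneg.2 huv)] at h
  exact h

/-- **Backward in time: large values propagate** (the argument for "`R(x,t) → +∞` as `t → T`
for each `x ∈ M ∖ Ω`", Chen–Zhu 2006, §4, p. 24). Let `φ` be continuous on `[a, b]` and, at
every `s ∈ [a, b]` with `φ s ≥ K` (`K > 0`), differentiable within `[a, b]` with
`|φ' s| ≤ η (φ s)²` (`η ≥ 0`). If `φ b > 0` and `φ(b)⁻¹ + η (b − a) < K⁻¹`, then on all of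
`[a, b]`: `K < φ s` and `φ(s)⁻¹ ≤ φ(b)⁻¹ + η (b − s)`. *Proof.* If `φ ≤ K` somewhere, at the last
such parameter `s₀` one has `φ s₀ = K` and `φ ≥ K` on `[s₀, b]`, so
`K⁻¹ = φ(s₀)⁻¹ ≤ φ(b)⁻¹ + η (b − s₀) < K⁻¹` by `abs_inv_sub_inv_le_of_deriv_le_sq` —
contradiction; then apply the same lemma on `[s, b]`. [cite: ChenZhu2006, §4, p. 24] -/
theorem lt_and_inv_le_of_deriv_le_sq {φ φ' : ℝ → ℝ} {a b K η : ℝ} (hφ : ContinuousOn φ (Icc a b))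
    (hK : 0 < K) (hη : 0 ≤ η)
    (hder : ∀ s ∈ Icc a b, K ≤ φ s → HasDerivWithinAt φ (φ' s) (Icc a b) s ∧ |φ' s| ≤ η * φ s ^ 2)
    (hb : 0 < φ b) (hsmall : (φ b)⁻¹ + η * (b - a) < K⁻¹) {s : ℝ} (hs : s ∈ Icc a b) :
    K < φ s ∧ (φ s)⁻¹ ≤ (φ b)⁻¹ + η * (b - s) := by
  have hab : a ≤ b := hs.1.trans hs.2
  -- the core estimate on a subinterval `[u, b]` where `φ ≥ K`
  have core : ∀ u ∈ Icc a b, (∀ s ∈ Icc u b, K ≤ φ s) → (φ u)⁻¹ ≤ (φ b)⁻¹ + η * (b - u) := by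
    intro u hu hKφ
    have hsub : Icc u b ⊆ Icc a b := Icc_subset_Icc_left hu.1
    have hder' : ∀ s ∈ Icc u b, HasDerivWithinAt φ (φ' s) (Icc u b) s := fun s hs ↦
      ((hder s (hsub hs) (hKφ s hs)).1).mono hsub
    have hb' : ∀ s ∈ Icc u b, |φ' s| ≤ η * φ s ^ 2 := fun s hs ↦ (hder s (hsub hs) (hKφ s hs)).2
    have h := abs_inv_sub_inv_le_of_deriv_le_sq hu.2 hK hder' hKφ hb'
    have := (abs_sub_le_iff.1 h).2
    linarith
  -- `φ b > K`
  have hbK : K < φ b := by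
    have h1 : (φ b)⁻¹ < K⁻¹ := by nlinarith [mul_nonneg hη (sub_nonneg.2 hab)]
    exact (inv_lt_inv₀ hb hK).1 h1
  -- `φ > K` on `[a, b]`
  have hall : ∀ s ∈ Icc a b, K < φ s := by
    by_contra hcon
    push Not at hcon
    obtain ⟨s₀, hs₀, hs₀K, hlt⟩ := exists_last_exit hφ hcon
    have hs₀b : s₀ < b := lt_of_le_of_ne hs₀.2 (by rintro rfl; exact absurd hs₀K hbK.not_ge)
    have hKs₀ : K ≤ φ s₀ := le_of_forall_Ioc_le hφ hs₀ hs₀b fun s hs ↦ (hlt s hs).le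
    have hKon : ∀ s ∈ Icc s₀ b, K ≤ φ s := by
      intro s hs'
      rcases hs'.1.eq_or_lt with rfl | hlt'
      · exact hKs₀
      · exact (hlt s ⟨hlt', hs'.2⟩).le
    have h1 := core s₀ hs₀ hKon
    have h2 : K⁻¹ ≤ (φ s₀)⁻¹ := inv_anti₀ (hK.trans_le hKs₀) hs₀K
    have h3 : η * (b - s₀) ≤ η * (b - a) := by gcongr; exact hs₀.1
    linarith
  refine ⟨hall s hs, core s hs fun u hu ↦ (hall u ⟨hs.1.trans hu.1, hu.2⟩).le⟩

/-- **Forward in time: bounded values stay bounded for a while** (the argument for "`Ω` is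
open", Chen–Zhu 2006, §4, p. 24). Let `φ` be continuous on `[a, b]` and, at every `s ∈ [a, b]`
with `φ s ≥ K` (`K > 0`), differentiable within `[a, b]` with `|φ' s| ≤ η (φ s)²` (`η ≥ 0`). If
`φ a ≤ L` with `L ≥ K`, then `φ s ≤ (L⁻¹ − η (s − a))⁻¹` for every `s ∈ [a, b]` with
`η (s − a) < L⁻¹`. *Proof.* If `φ s > L`, after the last parameter `s₁ ≤ s` with `φ s₁ ≤ L` one
has `φ ≥ L ≥ K`, so `φ(s)⁻¹ ≥ φ(s₁)⁻¹ − η (s − s₁) ≥ L⁻¹ − η (s − a) > 0`.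
[cite: ChenZhu2006, §4, p. 24] -/
theorem le_inv_sub_of_deriv_le_sq {φ φ' : ℝ → ℝ} {a b K η L : ℝ} (hφ : ContinuousOn φ (Icc a b))
    (hK : 0 < K) (hη : 0 ≤ η)
    (hder : ∀ s ∈ Icc a b, K ≤ φ s → HasDerivWithinAt φ (φ' s) (Icc a b) s ∧ |φ' s| ≤ η * φ s ^ 2)
    (hKL : K ≤ L) (ha : φ a ≤ L) {s : ℝ} (hs : s ∈ Icc a b) (hsmall : η * (s - a) < L⁻¹) :
    φ s ≤ (L⁻¹ - η * (s - a))⁻¹ := by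
  have hL : 0 < L := hK.trans_le hKL
  have hc : 0 < L⁻¹ - η * (s - a) := sub_pos.2 hsmall
  by_cases hsL : φ s ≤ L
  · refine hsL.trans ?_
    have h2 : L⁻¹ - η * (s - a) ≤ L⁻¹ := by linarith [mul_nonneg hη (sub_nonneg.2 hs.1)]
    calc L = (L⁻¹)⁻¹ := (inv_inv L).symm
      _ ≤ (L⁻¹ - η * (s - a))⁻¹ := inv_anti₀ hc h2
  push Not at hsL
  -- work on `[a, s]`
  have hφ' : ContinuousOn φ (Icc a s) := hφ.mono (Icc_subset_Icc_right hs.2)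
  obtain ⟨s₁, hs₁, hs₁L, hlt⟩ := exists_last_exit hφ' ⟨a, left_mem_Icc.2 hs.1, ha⟩
  have hs₁s : s₁ < s := lt_of_le_of_ne hs₁.2 (by rintro rfl; exact absurd hs₁L hsL.not_ge)
  have hLs₁ : L ≤ φ s₁ := le_of_forall_Ioc_le hφ' hs₁ hs₁s fun u hu ↦ (hlt u hu).le
  have hKon : ∀ u ∈ Icc s₁ s, K ≤ φ u := by
    intro u hu
    rcases hu.1.eq_or_lt with rfl | hlt'
    · exact hKL.trans hLs₁
    · exact hKL.trans (hlt u ⟨hlt', hu.2⟩).le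
  have hsub : Icc s₁ s ⊆ Icc a b := fun u hu ↦ ⟨hs₁.1.trans hu.1, hu.2.trans hs.2⟩
  have hder' : ∀ u ∈ Icc s₁ s, HasDerivWithinAt φ (φ' u) (Icc s₁ s) u := fun u hu ↦
    ((hder u (hsub hu) (hKon u hu)).1).mono hsub
  have hb' : ∀ u ∈ Icc s₁ s, |φ' u| ≤ η * φ u ^ 2 := fun u hu ↦ (hder u (hsub hu) (hKon u hu)).2
  have h := abs_inv_sub_inv_le_of_deriv_le_sq hs₁s.le hK hder' hKon hb'
  have h1 : (φ s₁)⁻¹ - η * (s - s₁) ≤ (φ s)⁻¹ := by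
    have := (abs_sub_le_iff.1 h).2
    linarith
  have h2 : L⁻¹ ≤ (φ s₁)⁻¹ := inv_anti₀ (hK.trans_le (hKon s₁ (left_mem_Icc.2 hs₁s.le))) hs₁L
  have h3 : η * (s - s₁) ≤ η * (s - a) := by gcongr; exact hs₁.1
  have h4 : L⁻¹ - η * (s - a) ≤ (φ s)⁻¹ := by linarith
  have hφs : 0 < φ s := hL.trans hsL
  calc φ s = ((φ s)⁻¹)⁻¹ := (inv_inv _).symm
    _ ≤ (L⁻¹ - η * (s - a))⁻¹ := inv_anti₀ hc h4

end Time

end Literature.Geometry.Riemannian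

end
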